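import Mathlib
import Summits.CriticalPhenomena.PercolationContinuityZ3.Theorems.PercNearOneGluingNoHeavyLowerTailHexMSMatchReduction

/-!
# The block-counting criterion for (MS2) (hp-7 gen 78)

Support file for crux `stmt-CriticalPhenomena-4575` (route `PercNearOneGluingNoHeavy`), hull-port seat `prim-hp-7` (generation 78);
`--supports stmt-CriticalPhenomena-4575 --as helper`.  No `sorry`.  Memo: `run/shared/lean/prim/prim-hp-7/FROM-prim-hp-7-g78-RECTANGLES-AND-REDUCTIONS.md` §7.

The counting form of order certificates (`Reduction.ms2_of_card_le_card_nonForward`: an injective reservation into the nonempty NON-FORWARD terms of a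
rank exists by cardinality alone — menus are irrelevant) specialised to the block rank `Q` before `P`:

* `BlockCount.ms2_of_blockCount` — if no member of `Q` lies inside a member of `P` and
  `#(D₅ ∪ D₂) ≤ #(C₅ ∪ SD_new)`, where `C₅ = (P \\ Q) \ (Q \\ P ∪ P \\ P ∪ Q \\ Q)` are the pure one-way cross differences (all purely backward
  under `Q < P`) and `SD_new = (P \\ D₅ ∪ Q \\ D₂) \ (F \\ F)` the new second differences, then (MS2) holds for `(P, Q, D₅, D₂)` — with no hypothesis
  on the designated sets beyond `D₅ ⊆ P \\ Q`, `D₂ ⊆ Q \\ P`.  By itself this criterion (in one of the two directions) covers 9 140 / 10 060 two-type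
  admissible instances on `2^[5]` and 921 810 / 1 104 600 on `2^[6]` (`#F ≤ 5`); it contains the new-block leaf, and with Ahlswede–Daykin's count
  `#D₅ ≤ #(P \\ D₅)` it contains the common-element theorem.
-/

namespace Summit.CriticalPhenomena.PercolationContinuityZ3.Theorems

namespace BlockCount

open Finset
open scoped FinsetFamily

variable {α : Type*} [DecidableEq α]

/-- **The block-counting criterion** (hp-7 gen 78).  Rank `Q` before `P` (inside a block by decreasing cardinality).  Every pure cross difference
`p \ q` that is not also a reverse cross difference or a same-block difference is then purely backward, and every second difference that is not a
difference of members is new; so if these two (disjoint) families together are at least as numerous as the designated sets, and no member of `Q`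
lies inside a member of `P`, then (MS2) holds.  No menu, no matching, no hypothesis on `D₅`, `D₂` beyond `D₅ ⊆ P \\ Q`, `D₂ ⊆ Q \\ P`.
(Mirror form: exchange the roles of the blocks and types.) -/
theorem ms2_of_blockCount (P Q D₅ D₂ : Finset (Finset α)) (hPQ : Disjoint P Q)
    (hD₅ : D₅ ⊆ P \\ Q) (hD₂ : D₂ ⊆ Q \\ P)
    (hcont : ∀ q ∈ Q, ∀ p ∈ P, ¬ q ⊆ p)
    (hcount : #(D₅ ∪ D₂) ≤
      #(((P \\ Q) \ ((Q \\ P) ∪ (P \\ P) ∪ (Q \\ Q))) ∪ (((P \\ D₅) ∪ (Q \\ D₂)) \ ((P ∪ Q) \\ (P ∪ Q))))) :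
    #((P ∪ Q) ∪ D₅ ∪ D₂) ≤ #(((P ∪ Q) \\ (P ∪ Q)) ∪ (P \\ D₅) ∪ (Q \\ D₂)) := by
  classical
  set F := P ∪ Q with hFdef
  set M : ℕ := F.sup card with hM
  have hcardM : ∀ {f : Finset α}, f ∈ F → #f ≤ M := fun hf => le_sup (f := card) hf
  -- the block rank: `Q` first, then `P`, inside a block by decreasing cardinality
  let r : Finset α → ℤ := fun f => (if f ∈ P then (M : ℤ) + 1 else 0) - (#f : ℤ)
  have hQnotP : ∀ {q : Finset α}, q ∈ Q → q ∉ P := fun hq hp => disjoint_left.mp hPQ hp hq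
  refine Reduction.ms2_of_card_le_card_nonForward P Q D₅ D₂ hD₅ hD₂ r ?_ (hcount.trans (card_le_card ?_))
  · -- no earlier member inside a later one
    intro f hf g hg hne hr hsub
    rcases mem_union.mp hf with hfP | hfQ <;> rcases mem_union.mp hg with hgP | hgQ
    · have : r f ≤ r g := hr
      simp only [r, if_pos hfP, if_pos hgP] at this
      have hle : #g ≤ #f := by omega
      exact hne (eq_of_subset_of_card_le hsub hle)
    · have : r f ≤ r g := hr
      simp only [r, if_pos hfP, if_neg (hQnotP hgQ)] at this
      have := hcardM hf
      omega
    · exact hcont f hfQ g hgP hsub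
    · have : r f ≤ r g := hr
      simp only [r, if_neg (hQnotP hfQ), if_neg (hQnotP hgQ)] at this
      have hle : #g ≤ #f := by omega
      exact hne (eq_of_subset_of_card_le hsub hle)
  · -- the two families consist of nonempty non-forward terms
    intro t ht
    rw [mem_filter]
    rcases mem_union.mp ht with ht | ht
    · obtain ⟨htPQ, hnot⟩ := mem_sdiff.mp ht
      obtain ⟨p, hp, q, hq, rfl⟩ := mem_diffs.mp htPQ
      have hT : p \ q ∈ ((P ∪ Q) \\ (P ∪ Q)) ∪ (P \\ D₅) ∪ (Q \\ D₂) :=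
        mem_union_left _ (mem_union_left _ (mem_diffs.mpr ⟨p, mem_union_left _ hp, q, mem_union_right _ hq, rfl⟩))
      refine ⟨hT, ?_, ?_⟩
      · intro h0
        exact hnot (mem_union_left _ (mem_union_right _ (h0 ▸ mem_diffs.mpr ⟨p, hp, p, hp, by simp⟩)))
      · intro f hf g hg hne hr heq
        rcases mem_union.mp hf with hfP | hfQ <;> rcases mem_union.mp hg with hgP | hgQ
        · exact hnot (mem_union_left _ (mem_union_right _ (heq ▸ mem_diffs.mpr ⟨f, hfP, g, hgP, rfl⟩)))
        · have : r f ≤ r g := hr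
          simp only [r, if_pos hfP, if_neg (hQnotP hgQ)] at this
          have := hcardM hf
          omega
        · exact hnot (mem_union_left _ (mem_union_left _ (heq ▸ mem_diffs.mpr ⟨f, hfQ, g, hgP, rfl⟩)))
        · exact hnot (mem_union_right _ (heq ▸ mem_diffs.mpr ⟨f, hfQ, g, hgQ, rfl⟩))
    · obtain ⟨htSD, hnot⟩ := mem_sdiff.mp ht
      have hT : t ∈ ((P ∪ Q) \\ (P ∪ Q)) ∪ (P \\ D₅) ∪ (Q \\ D₂) := by
        rcases mem_union.mp htSD with h | h
        · exact mem_union_left _ (mem_union_right _ h)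
        · exact mem_union_right _ h
      have hFne : F.Nonempty := by
        rcases mem_union.mp htSD with h | h
        · obtain ⟨p, hp, -, -, -⟩ := mem_diffs.mp h; exact ⟨p, mem_union_left _ hp⟩
        · obtain ⟨q, hq, -, -, -⟩ := mem_diffs.mp h; exact ⟨q, mem_union_right _ hq⟩
      refine ⟨hT, ?_, ?_⟩
      · intro h0
        obtain ⟨f₀, hf₀⟩ := hFne
        exact hnot (h0 ▸ mem_diffs.mpr ⟨f₀, hf₀, f₀, hf₀, by simp⟩)
      · intro f hf g hg _ _ heq
        exact hnot (heq ▸ mem_diffs.mpr ⟨f, hf, g, hg, rfl⟩)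



/-- The mirror form of `ms2_of_blockCount` (hp-7 gen 78): rank `P` before `Q`; (MS2) whenever no member of `P` lies inside a member of `Q` and the
designated sets are at most as numerous as the pure one-way cross differences `C₂ = (Q \\ P) \ (P \\ Q ∪ P \\ P ∪ Q \\ Q)` plus the new second
differences. -/
theorem ms2_of_blockCount' (P Q D₅ D₂ : Finset (Finset α)) (hPQ : Disjoint P Q)
    (hD₅ : D₅ ⊆ P \\ Q) (hD₂ : D₂ ⊆ Q \\ P)
    (hcont : ∀ p ∈ P, ∀ q ∈ Q, ¬ p ⊆ q)
    (hcount : #(D₅ ∪ D₂) ≤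
      #(((Q \\ P) \ ((P \\ Q) ∪ (P \\ P) ∪ (Q \\ Q))) ∪ (((P \\ D₅) ∪ (Q \\ D₂)) \ ((P ∪ Q) \\ (P ∪ Q))))) :
    #((P ∪ Q) ∪ D₅ ∪ D₂) ≤ #(((P ∪ Q) \\ (P ∪ Q)) ∪ (P \\ D₅) ∪ (Q \\ D₂)) := by
  classical
  have hcount' : #(D₂ ∪ D₅) ≤
      #(((Q \\ P) \ ((P \\ Q) ∪ (Q \\ Q) ∪ (P \\ P))) ∪ (((Q \\ D₂) ∪ (P \\ D₅)) \ ((Q ∪ P) \\ (Q ∪ P)))) := by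
    have e : ((Q \\ P) \ ((P \\ Q) ∪ (Q \\ Q) ∪ (P \\ P))) ∪ (((Q \\ D₂) ∪ (P \\ D₅)) \ ((Q ∪ P) \\ (Q ∪ P))) =
        ((Q \\ P) \ ((P \\ Q) ∪ (P \\ P) ∪ (Q \\ Q))) ∪ (((P \\ D₅) ∪ (Q \\ D₂)) \ ((P ∪ Q) \\ (P ∪ Q))) := by
      rw [union_comm Q P, union_comm (Q \\ D₂) (P \\ D₅), union_assoc (P \\ Q) (Q \\ Q) (P \\ P), union_comm (Q \\ Q) (P \\ P), ← union_assoc]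
    rw [union_comm D₂ D₅, e]
    exact hcount
  have h := ms2_of_blockCount Q P D₂ D₅ hPQ.symm hD₂ hD₅ hcont hcount'
  have e1 : (Q ∪ P) ∪ D₂ ∪ D₅ = (P ∪ Q) ∪ D₅ ∪ D₂ := by
    rw [union_comm Q P, union_assoc, union_comm D₂ D₅, ← union_assoc]
  have e2 : ((Q ∪ P) \\ (Q ∪ P)) ∪ (Q \\ D₂) ∪ (P \\ D₅) = ((P ∪ Q) \\ (P ∪ Q)) ∪ (P \\ D₅) ∪ (Q \\ D₂) := by
    rw [union_comm Q P, union_assoc, union_comm (Q \\ D₂) (P \\ D₅), ← union_assoc]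
  rw [e1, e2] at h
  exact h

end BlockCount

end Summit.CriticalPhenomena.PercolationContinuityZ3.Theorems
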